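import Summits.NavierStokesRegularity.NavierStokesRegularity.Theorems.HeredityAtOne.Negative.EnergyImpulseBound
import Summits.NavierStokesRegularity.NavierStokesRegularity.Theorems.HeredityAtOne.Negative.CapStratumEnergyWindow
import HarnessLib

/-!
# The UNCONDITIONAL energy door of the silent signed swirl-free sub-register (disprover g5 on item 19249)

Third of three files (`AxialRayMean` → `EnergyImpulseBound` → `CapStratumEnergyBound`); sequel of
`CapStratumEnergyWindow.lean` (p511215), which ran the energy door of the silent signed swirl-free sub-register of
`HeredityAtOne` CONDITIONALLY on a brick `hκ : E(w) ≤ κ · sup‖w‖ · ∫ r²(ω_θ/r)`. With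
`kineticEnergy_le_quarter_speed_mul_integral_swirl_curl` (`EnergyImpulseBound`) the brick holds with `κ = ¼`,
and every door theorem becomes hypothesis-free. No definitions, no named facts.

* `kineticEnergy_le_quarter_of_signedNoSwirlSlice` — the brick for `C³` single-signed swirl-free slices
  (`SignedNoSwirlSlice w M`, divergence free, `L²`, `‖w‖ ≤ U`): `E(w) ≤ ¼ · U · ∫ r²(ω_θ/r)`
  (`(x × curl w)₃ = r²(ω_θ/r)`, tree `IsAxisymmetric.swirl_curl_eq_cylRadius_sq_mul_angVortQuot`).
* `kineticEnergy_le_quarter_of_silent_signed_host` — on a SILENT design (`S.f = 0` on `[τ₀, ∞)`) with globally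
  anchored margins (`Margins.routeG`) whose host slice `s.u τ₀` is single-signed swirl-free: for every
  `t ∈ [τ₀, τ_k]`, `E(s.u t) ≤ ¼ · c₁Y₀ · ∫ r²η(s.u t)` (energy decay `kineticEnergy_le_of_sobolevDatum`, conserved
  impulse `integral_rsq_angVortQuot_eq_of_sobolevDatum`, window pin `‖s.u τ₀‖ ≤ c₁Y₀`).
* `four_mul_Y_mul_kineticEnergy_le_of_silent_signed_host` — at a registered readout `τ_j`, `j ≤ k`, for every
  speed bound `V` of that slice: `4 · Y_j · E(s.u τ_j) ≤ Y₀ · V · ∫ r²η(s.u τ_j)` (floor `‖s.u τ_j (x_j)‖ ≥ c₁Y_j`).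
* `eight_mul_kineticEnergy_le_of_silent_signed_host` — wide rates (`2Y₀ ≤ Y₁ ≤ Y_j`, `TowerRates.wide_sep`),
  `1 ≤ j ≤ k`: **`8 · E(s.u τ_j) ≤ V · ∫ r²η(s.u τ_j)`**; with the sharper `Y₀/Y₁ = 1351.2/2778.4 = 0.4863`,
  `E ≤ 0.1216 · V∫r²η` at `τ₁`.
* `speed_and_energy_doors_of_silent_signed_host` — both doors at a level `k ≥ 1`: the top readout slice must pass
  the Gallay–Šverák speed cap `c₁Y_k ≤ 0.35356 √(√((∫η)(∫r²η)) M)` (host form, `floor_le_cap_τ_zero_of_silent`;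
  efficiency `e > 0.160`: fat-cored / near-axis profiles only, thin rings `e ≈ 0.11` fail) AND the energy cap
  `ε := E/(V∫r²η) ≤ ⅛` (thin-cored profiles only: Hill's spherical vortex has `ε = 1/7 = 0.1429 > ⅛`, so it — and
  the lazy `τ₁`-slice `hillField` of `LazyEnvelopeSlice(.Signed)`, a Hill field — is EXCLUDED as a registered
  readout slice of this sub-register by the energy, where the speed cap, `e_Hill = 0.2048 > 0.160`, let it pass).
  The two doors pull in opposite directions (speed-efficient = fat, energy-inefficient = thin); whether one
  axisymmetric signed swirl-free profile passes both (`e > 0.160 ∧ ε < 0.1216`) is what the `(e, ε)`-scan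
  job:j272424 of this seat measures (uniform-`η` tori of all aspect ratios, Gaussian-core rings, Hill).

Junction with the impulse ledger of the sibling files (`StageImpulseLedger`, `CapStratumImpulseBalance`,
`Literature/…/HydrodynamicImpulseBalanceEnergy`: `∫ r²η(s.u t) = 2∫₀ᵗ∫(S.f)₃ =: 2Π(t)`, the design's total axial
push): on the silent signed sub-register `E(s.u t) ≤ ½ · c₁Y₀ · Π` for `t ∈ [τ₀, τ_k]` and `4 E(s.u τ_j) ≤ V_j Π`
(`j ≥ 1`, wide rates), with no hypothesis beyond the sub-register's definition.

What this does NOT do: it does not empty `CapStratumEmptyAt 1` (p481383) — thin signed rings pass the energy door,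
fat ones the speed door, and nothing here controls the NS evolution between `τ₀` and `τ₁` beyond energy decay and
impulse conservation — and it says nothing about non-silent or unsigned designs. Item 19249 stays OPEN (no kill;
repair of record `HeredityAtOffStratum 1`, p481383, or the banked `∃`-ladder p434821).

References: T. Gallay, V. Šverák, Confluentes Math. 7 (2015), (1.3), Prop. 2.6, Lemma 6.4
[cite: GallaySverak2016, Lemma 6.4]; J. Leray, Acta Math. 63 (1934), §32 [cite: Leray1934, §32];
P. G. Saffman, *Vortex Dynamics* (1992), §3.2 [cite: Saffman1992, §3.2 eq. (3.2.11)];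
S. Palasek (2026), §4 [cite: Palasek2026ElementaryModel, §4].
-/

noncomputable section

namespace Summit.NavierStokesRegularity.HeredityAtOneEnergyBound

open Set MeasureTheory Filter Topology Function
open scoped ContDiff ENNReal Topology
open Literature.Analysis Literature.Analysis.FluidPDE


/-! ## The energy door on the register, unconditionally (`κ = ¼`) -/

open Summit.NavierStokesRegularity.FluidComputer
open Summit.NavierStokesRegularity.FluidComputer.PalasekTowerClayBridge
open Summit.NavierStokesRegularity.NavierStokesRegularity
open Summit.NavierStokesRegularity.HeredityAtOneNoSwirlCap
open Summit.NavierStokesRegularity.HeredityAtOneSpeedCap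
open Summit.NavierStokesRegularity.HeredityAtOneNoSwirlStratum
open Summit.NavierStokesRegularity.HeredityAtOneSilentWindow
open Summit.NavierStokesRegularity.HeredityAtOneEnergyWindow

/-- **The brick `hκ` of `CapStratumEnergyWindow.lean`, discharged with `κ = ¼`** (for `C³` fields, which
covers every registered slice): a single-signed swirl-free slice `w` (`SignedNoSwirlSlice w M`) that is `C³`,
divergence free, square integrable and bounded by `U` has `E(w) ≤ ¼ · U · ∫ r²(ω_θ/r)`.
(`(x × curl w)₃ = r²·(ω_θ/r)`, tree `IsAxisymmetric.swirl_curl_eq_cylRadius_sq_mul_angVortQuot`.)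
[cite: GallaySverak2016, §1 (1.3) (arXiv p. 2)] -/
theorem kineticEnergy_le_quarter_of_signedNoSwirlSlice
    {w : EuclideanSpace ℝ (Fin 3) → EuclideanSpace ℝ (Fin 3)} {M U : ℝ}
    (hsl : SignedNoSwirlSlice w M) (hw : ContDiff ℝ 3 w) (hdiv : VectorCalculus.IsDivFree w)
    (hL2 : Integrable (fun x => ‖w x‖ ^ 2)) (hU : ∀ x, ‖w x‖ ≤ U) :
    VectorCalculus.kineticEnergy w ≤ 1 / 4 * U * ∫ y, cylRadius y ^ 2 * angVortQuot w y := by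
  have hid : (fun x => swirl (FluidPDE.curl w) x) = fun x => cylRadius x ^ 2 * angVortQuot w x :=
    hsl.axisym.swirl_curl_eq_cylRadius_sq_mul_angVortQuot hw
  have hint : Integrable (fun x => swirl (FluidPDE.curl w) x) := by rw [hid]; exact hsl.integrable_sq
  have hsign : ∀ x, 0 ≤ swirl (FluidPDE.curl w) x := fun x => by
    rw [← hsl.axisym.cylRadius_sq_mul_angVortQuot hw x]; exact mul_nonneg (sq_nonneg _) (hsl.nonneg x)
  have h := kineticEnergy_le_quarter_speed_mul_integral_swirl_curl (hw.of_le (by norm_cast)) hdiv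
    hsl.noSwirl hL2 hU hsign hint
  rw [hid] at h
  calc VectorCalculus.kineticEnergy w ≤ U / 4 * ∫ x, cylRadius x ^ 2 * angVortQuot w x := h
    _ = 1 / 4 * U * ∫ y, cylRadius y ^ 2 * angVortQuot w y := by ring

variable {R : TowerRates} {S : Schedule R} {k : ℕ}

/-- **Energy ≤ ¼ · host speed · impulse along a silent signed run** (`CapStratumEnergyWindow`'s
`kineticEnergy_le_of_silent_signed_host` with `hκ` discharged, `κ = ¼`): on a silent design with globally
anchored margins whose host slice is single-signed swirl-free, for every `t ∈ [τ₀, τ_k]`,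
`E(s.u t) ≤ ¼ · c₁Y₀ · ∫ r²η(s.u t)` (energy decay + conserved impulse + window pin `‖s.u τ₀‖ ≤ c₁Y₀`).
[cite: Leray1934, §32] [cite: GallaySverak2016, Lemma 6.4] -/
theorem kineticEnergy_le_quarter_of_silent_signed_host (hSil : ∀ t, S.τ 0 ≤ t → S.f t = 0)
    (s : Stage 1 R S (Margins.routeG R) k) {M : ℝ} (hsl : SignedNoSwirlSlice (s.u (S.τ 0)) M) :
    ∀ t ∈ Icc (S.τ 0) (S.τ k),
      VectorCalculus.kineticEnergy (s.u t) ≤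
        1 / 4 * (S.c₁ * R.Y 0) * ∫ y, cylRadius y ^ 2 * angVortQuot (s.u t) y := by
  have h0 : S.τ 0 ∈ Icc 0 (S.τ k) := s.τ_zero_mem_Icc
  have hhost : VectorCalculus.kineticEnergy (s.u (S.τ 0)) ≤
      1 / 4 * (S.c₁ * R.Y 0) * ∫ y, cylRadius y ^ 2 * angVortQuot (s.u (S.τ 0)) y :=
    kineticEnergy_le_quarter_of_signedNoSwirlSlice hsl
      ((s.classical.contDiff_velocity h0).of_le (by norm_cast)) (s.classical.divFree _ h0)
      (integrable_norm_sq_slice s h0) s.norm_τ_zero_le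
  intro t ht
  rcases (S.τ_mono (Nat.zero_le k)).eq_or_lt with h0k | h0k
  · have htt : t = S.τ 0 := le_antisymm (h0k ▸ ht.2) ht.1
    rw [htt]
    exact hhost
  · obtain ⟨hcl, hf0, hE⟩ := run_from_τ_zero hSil s h0k
    have hEt := (kineticEnergy_le_of_sobolevDatum (stage_hasBoundedSobolevNormsOn s) s.τ_zero_mem_Icc
      h0k S.f s.u s.p hcl hf0 hE rfl t ht).1
    have hI := integral_rsq_angVortQuot_eq_of_sobolevDatum (stage_hasBoundedSobolevNormsOn s)
      s.τ_zero_mem_Icc hsl h0k S.f s.u s.p hcl hf0 hE rfl t ht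
    rw [hI]
    exact hEt.trans hhost

/-- **Energy efficiency at a registered readout, unconditionally**: on a silent design with globally anchored
margins and single-signed swirl-free host, at every registered readout `τ_j`, `j ≤ k`, and for every bound `V`
of the slice speed, `4 · Y_j · E(s.u τ_j) ≤ Y₀ · V · ∫ r²η(s.u τ_j)`. [cite: Leray1934, §32]
[cite: GallaySverak2016, Lemma 6.4] [cite: Palasek2026ElementaryModel, §4] -/
theorem four_mul_Y_mul_kineticEnergy_le_of_silent_signed_host (hSil : ∀ t, S.τ 0 ≤ t → S.f t = 0)
    (s : Stage 1 R S (Margins.routeG R) k) {M : ℝ} (hsl : SignedNoSwirlSlice (s.u (S.τ 0)) M)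
    {j : ℕ} (hj : j ≤ k) {V : ℝ} (hV : ∀ x, ‖s.u (S.τ j) x‖ ≤ V) :
    4 * R.Y j * VectorCalculus.kineticEnergy (s.u (S.τ j)) ≤
      R.Y 0 * V * ∫ y, cylRadius y ^ 2 * angVortQuot (s.u (S.τ j)) y := by
  have hτj : S.τ j ∈ Icc (S.τ 0) (S.τ k) := ⟨S.τ_mono (Nat.zero_le j), S.τ_mono hj⟩
  have hE := kineticEnergy_le_quarter_of_silent_signed_host hSil s hsl (S.τ j) hτj
  obtain ⟨x, -, hfl⟩ := s.floor j hj
  have hcV : S.c₁ * R.Y j ≤ V := hfl.trans (hV x)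
  have hslj : SignedNoSwirlSlice (s.u (S.τ j)) M := signedNoSwirlSlice_of_silent hSil s hsl _ hτj
  have hI0 : 0 ≤ ∫ y, cylRadius y ^ 2 * angVortQuot (s.u (S.τ j)) y :=
    integral_nonneg fun y => mul_nonneg (sq_nonneg _) (hslj.nonneg y)
  have hY0 : 0 < R.Y 0 := Real.rpow_pos_of_pos (R.N_pos 0) _
  have hYj : 0 < R.Y j := Real.rpow_pos_of_pos (R.N_pos j) _
  calc 4 * R.Y j * VectorCalculus.kineticEnergy (s.u (S.τ j))
      ≤ 4 * R.Y j * (1 / 4 * (S.c₁ * R.Y 0) * ∫ y, cylRadius y ^ 2 * angVortQuot (s.u (S.τ j)) y) :=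
        mul_le_mul_of_nonneg_left hE (by positivity)
    _ = (S.c₁ * R.Y j) * (R.Y 0 * ∫ y, cylRadius y ^ 2 * angVortQuot (s.u (S.τ j)) y) := by ring
    _ ≤ V * (R.Y 0 * ∫ y, cylRadius y ^ 2 * angVortQuot (s.u (S.τ j)) y) :=
        mul_le_mul_of_nonneg_right hcV (mul_nonneg hY0.le hI0)
    _ = R.Y 0 * V * ∫ y, cylRadius y ^ 2 * angVortQuot (s.u (S.τ j)) y := by ring

/-- **Wide rates, unconditionally: `8 E ≤ V · ∫ r²η` at every registered readout `τ_j`, `j ≥ 1`**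
(`2Y_j ≤ Y_{j+1}`, `TowerRates.wide_sep`; with the sharper `Y₀/Y₁ = 0.4863`, `E ≤ 0.1216 · V ∫r²η` at `τ₁`).
Hill's spherical vortex has `E = V ∫r²η / 7 = 0.1429 · V ∫r²η > ⅛ V ∫r²η`: it, and with it the lazy
`τ₁`-slice `hillField` of `LazyEnvelopeSlice(.Signed)`, is EXCLUDED as a registered readout slice of the silent
signed swirl-free sub-register — by the energy, where the speed cap (`e_Hill = 0.2048 > 0.160`) lets it pass.
[cite: Leray1934, §32] [cite: GallaySverak2016, Lemma 6.4] [cite: Palasek2026ElementaryModel, §4] -/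
theorem eight_mul_kineticEnergy_le_of_silent_signed_host {S : Schedule TowerRates.wide}
    (hSil : ∀ t, S.τ 0 ≤ t → S.f t = 0) (s : Stage 1 TowerRates.wide S (Margins.routeG TowerRates.wide) k)
    {M : ℝ} (hsl : SignedNoSwirlSlice (s.u (S.τ 0)) M) {j : ℕ} (h1j : 1 ≤ j) (hj : j ≤ k) {V : ℝ}
    (hV : ∀ x, ‖s.u (S.τ j) x‖ ≤ V) :
    8 * VectorCalculus.kineticEnergy (s.u (S.τ j)) ≤ V * ∫ y, cylRadius y ^ 2 * angVortQuot (s.u (S.τ j)) y := by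
  have h := four_mul_Y_mul_kineticEnergy_le_of_silent_signed_host hSil s hsl hj hV
  have hmono : StrictMono TowerRates.wide.Y := strictMono_nat_of_lt_succ TowerRates.wide.Y_lt_Y_succ
  have hY1j : TowerRates.wide.Y 1 ≤ TowerRates.wide.Y j := hmono.monotone h1j
  have hsep := TowerRates.wide_sep 0
  have hτj : S.τ j ∈ Icc (S.τ 0) (S.τ k) := ⟨S.τ_mono (Nat.zero_le j), S.τ_mono hj⟩
  have hslj : SignedNoSwirlSlice (s.u (S.τ j)) M := signedNoSwirlSlice_of_silent hSil s hsl _ hτj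
  have hI0 : 0 ≤ ∫ y, cylRadius y ^ 2 * angVortQuot (s.u (S.τ j)) y :=
    integral_nonneg fun y => mul_nonneg (sq_nonneg _) (hslj.nonneg y)
  have hV0 : 0 ≤ V := (norm_nonneg _).trans (hV 0)
  have hE0 : 0 ≤ VectorCalculus.kineticEnergy (s.u (S.τ j)) := kineticEnergy_nonneg _
  have hY0 : 0 < TowerRates.wide.Y 0 := Real.rpow_pos_of_pos (TowerRates.wide.N_pos 0) _
  have hP : 0 ≤ V * ∫ y, cylRadius y ^ 2 * angVortQuot (s.u (S.τ j)) y := mul_nonneg hV0 hI0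
  nlinarith

/-- **Both doors at once, unconditionally (silent signed sub-register, level `k ≥ 1`).** On a silent wide
design with globally anchored margins whose host is single-signed swirl-free of height `M`, a registered stage
at a level `k ≥ 1` has, at its top readout `τ_k` and for every speed bound `V` of that slice, BOTH the speed cap
`c₁Y_k ≤ 0.35356 √(√((∫η)(∫r²η)) M)` (host form) AND the energy cap `8 E ≤ V ∫r²η`: a registered readout slice
must be speed-efficient (`e > 0.160`: fat-cored / near-axis) and energy-INefficient (`ε ≤ ⅛`, indeed
`≤ 0.1216`: thin-cored) at once. [cite: GallaySverak2016, Prop. 2.6 (2.14), Lemma 6.4] [cite: Leray1934, §32]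
[cite: Palasek2026ElementaryModel, §4] -/
theorem speed_and_energy_doors_of_silent_signed_host {S : Schedule TowerRates.wide}
    (hSil : ∀ t, S.τ 0 ≤ t → S.f t = 0) (hk : 1 ≤ k)
    (s : Stage 1 TowerRates.wide S (Margins.routeG TowerRates.wide) k) {M : ℝ}
    (hsl : SignedNoSwirlSlice (s.u (S.τ 0)) M) {V : ℝ} (hV : ∀ x, ‖s.u (S.τ k) x‖ ≤ V) :
    S.c₁ * TowerRates.wide.Y k ≤ 0.35356 * Real.sqrt (Real.sqrt ((∫ y, angVortQuot (s.u (S.τ 0)) y) *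
        ∫ y, cylRadius y ^ 2 * angVortQuot (s.u (S.τ 0)) y) * M) ∧
      8 * VectorCalculus.kineticEnergy (s.u (S.τ k)) ≤ V * ∫ y, cylRadius y ^ 2 * angVortQuot (s.u (S.τ k)) y :=
  ⟨floor_le_cap_τ_zero_of_silent isNoSwirlCapConstant_eighth hSil hk s hsl le_rfl,
    eight_mul_kineticEnergy_le_of_silent_signed_host hSil s hsl hk le_rfl hV⟩


end Summit.NavierStokesRegularity.HeredityAtOneEnergyBound
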